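import Mathlib
import HarnessLib
import Literature.Analysis.FluidPDE.RieszPressureModConst
import Literature.Analysis.FluidPDE.NormalisedPressureL2Bound
import Literature.Analysis.FluidPDE.PineauVicolLocalPressureMass
import Summits.NavierStokesRegularity.NavierStokesRegularity.Theorems.PoloidalWindowDoorPoloidalWindowRigiditySparseEnergyPressureScale

/-!
# Route `PoloidalWindowDoor`, crux `PoloidalWindowRigidity` (stmt-19708), line `sparse_energy` — stub S1, FILE C
# (discharge of the window pressure split), pieces C2/C5: NEAR LOCALITY, THE `L²` BOUND OF THE NEAR PART, AND THE SLICE SPLIT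

Seat ns-es-p1 g4 (prover; `--supports stmt-NavierStokesRegularity-19708`; KEY-NS #134; static division with the LEAD-lineage seat
K2-p2 g10 of pub/ns-regularity-ideate/STATUS 11:48Z: es-p1 = C2 + C5, K2-p2 g10 = C6).  For a bounded smooth field `u` (`‖u‖ ≤ N`),
a centre `a`, a radius `R > 0`, the cut field `w = ϑ • u`, `ϑ = cutoff (4R) (a − ·)`:

* C2 `nearPotential_congr_ball` / `nearPotential_eq_cutField` — the near potential `Q₁^{r₀,r₁}` only sees the field on `B(x, r₁)`; for
  `x ∈ B̄(a,2R)` and radii `(R, 2R)`: `Q₁^{R,2R}[u](x) = Q₁^{R,2R}[w](x)`;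
* C5 `exists_sqrt_setIntegral_sq_pressurePotential_cutField_le` — `√∫_{B̄(a,2R)} Q[w]² ≤ κ₁ N √∫ cutoff(8R)(a−·)‖u‖²` with `κ₁` the
  tree's Stein constant (`stein1970_normalisedPressure_eLpNorm_le_holds`, `p = 2`; `Q[w] = p̃[w]` by `normalisedPressure_eq_pressurePotential'`;
  `‖w‖⁴ ≤ N²‖w‖²`, `ϑ² ≤ cutoff(8R)(a−·)`);
* the slice split `exists_pressurePotentialMod_split` — `pressurePotentialMod x₀ u = c + Q[w] + (Q₂^{R,2R}[w] − farPotentialMod R 2R x₀ u)` on `B̄(a,2R)`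
  (C1 of K2-p2 g9 `exists_pressurePotentialMod_eq_scale_add_const`, C2, and the tree's `pressurePotential_eq_scale`).

Together with `…SparseEnergyPressureSplitFar.abs_farSplit_sub_le` (C3/C4, this seat) these are the three clauses of the window hypothesis `hwin`
of `…SparseEnergyScaledEnergyOfSplit.scaledEnergy_of_split`; the class assembly (C6) is K2-p2 g10's.

WHAT THIS IS NOT: not a claim about Navier–Stokes; potential theory of bounded fields (bears_on LADDER-NS N0 via crux 19708, line sparse_energy,
stub S1).  No summit statement is proved here.
-/

noncomputable section

-- the summit and its single sub-problem share the name (CONVENTIONS §1), as in every Theorems file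
set_option linter.dupNamespace false

namespace Summit.NavierStokesRegularity.NavierStokesRegularity.Theorems.PoloidalWindowDoorPoloidalWindowRigiditySparseEnergyPressureSplitNear

-- nested operator types `ℝ³ →L[ℝ] ℝ³ →L[ℝ] ℝ³ →L[ℝ] ℝ`
set_option maxSynthPendingDepth 3

open MeasureTheory Set Function Filter Topology Metric
open scoped ENNReal ContDiff
open Literature.Analysis Literature.Analysis.FluidPDE
open Summit.NavierStokesRegularity.NavierStokesRegularity.Theorems.PoloidalWindowDoorPoloidalWindowRigiditySparseEnergyPressureScale

/-! ### C2: locality of the near potential -/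

variable {r₀ r₁ : ℝ}

/-- **The near potential is local**: `Q₁^{r₀,r₁}[v](x) = Q₁^{r₀,r₁}[w](x)` as soon as `v = w` on the open ball `B(x, r₁)`
(`Γ₀^{r₀,r₁}` vanishes for `‖z‖ ≥ r₁`, and the source `∂ᵢ∂ⱼ(vᵢvⱼ)` is a local expression). -/
theorem nearPotential_congr_ball (h₀ : 0 ≤ r₀) (h₁ : r₀ < r₁) {v w : EuclideanSpace ℝ (Fin 3) → EuclideanSpace ℝ (Fin 3)}
    {x : EuclideanSpace ℝ (Fin 3)} (h : ∀ y ∈ ball x r₁, v y = w y) :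
    nearPotential r₀ r₁ v x = nearPotential r₀ r₁ w x := by
  rw [nearPotential, nearPotential]
  refine integral_congr_ae (Eventually.of_forall fun z => ?_)
  by_cases hz : ‖z‖ < r₁
  · have hmem : x - z ∈ ball x r₁ := by
      rw [mem_ball, dist_eq_norm, sub_sub_cancel_left, norm_neg]; exact hz
    have hev : v =ᶠ[𝓝 (x - z)] w := by
      filter_upwards [isOpen_ball.mem_nhds hmem] with y hy using h y hy
    simp only
    rw [PineauVicol2026.pressureSource_congr_of_eventuallyEq hev]
  · rw [not_lt] at hz
    simp only
    rw [newtonNear_eq_zero h₀ h₁ hz, zero_mul, zero_mul]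

/-- **C2 for the cut field**: for `x ∈ B̄(a,2R)`, `Q₁^{R,2R}[u](x) = Q₁^{R,2R}[ϑ • u](x)`, `ϑ = cutoff (4R) (a − ·)` (`= 1` on
`B(a,4R) ⊇ B(x,2R)`). -/
theorem nearPotential_eq_cutField {R : ℝ} (hR : 0 < R) {u : EuclideanSpace ℝ (Fin 3) → EuclideanSpace ℝ (Fin 3)}
    {a x : EuclideanSpace ℝ (Fin 3)} (hx : x ∈ closedBall a (2 * R)) :
    nearPotential (R * 1) (R * 2) u x = nearPotential (R * 1) (R * 2) (fun z => cutoff (4 * R) (a - z) • u z) x := by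
  refine nearPotential_congr_ball (by positivity) (by linarith) fun y hy => ?_
  rw [mem_closedBall, dist_eq_norm] at hx
  rw [mem_ball, dist_eq_norm, norm_sub_rev] at hy
  have hay : ‖a - y‖ ≤ 4 * R := by
    have := norm_sub_le_norm_sub_add_norm_sub a x y
    rw [norm_sub_rev a x] at this
    linarith
  rw [cutoff_eq_one (by positivity) hay, one_smul]

/-! ### C5: the `L²` bound of the near part `Q[ϑ • u]` -/

/-- The cut field `w = ϑ • u` of a smooth bounded field: smooth, compactly supported, `‖w‖ ≤ ‖u‖`, `‖w‖² ≤ cutoff(8R)(a−·)‖u‖²`. -/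
theorem cutField_smooth {u : EuclideanSpace ℝ (Fin 3) → EuclideanSpace ℝ (Fin 3)} (hu : ContDiff ℝ ∞ u)
    (a : EuclideanSpace ℝ (Fin 3)) {R : ℝ} (hR : 0 < R) :
    ContDiff ℝ ∞ (fun z => cutoff (4 * R) (a - z) • u z) ∧
    HasCompactSupport (fun z => cutoff (4 * R) (a - z) • u z) ∧
    (∀ z, ‖cutoff (4 * R) (a - z) • u z‖ ≤ ‖u z‖) ∧
    (∀ z, ‖cutoff (4 * R) (a - z) • u z‖ ^ 2 ≤ cutoff (8 * R) (a - z) * ‖u z‖ ^ 2) := by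
  have hϑ : ContDiff ℝ ∞ fun z : EuclideanSpace ℝ (Fin 3) => cutoff (4 * R) (a - z) :=
    (contDiff_cutoff _).comp (contDiff_const.sub contDiff_id)
  refine ⟨hϑ.smul hu, ?_, fun z => ?_, fun z => ?_⟩
  · refine HasCompactSupport.intro (isCompact_closedBall a (8 * R)) fun z hz => ?_
    rw [mem_closedBall, dist_eq_norm, norm_sub_rev, not_le] at hz
    rw [cutoff_eq_zero (by positivity) (by linarith), zero_smul]
  · rw [norm_smul, Real.norm_eq_abs, abs_of_nonneg (cutoff_nonneg _ _)]
    exact mul_le_of_le_one_left (norm_nonneg _) (cutoff_le_one _ _)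
  · rw [norm_smul, Real.norm_eq_abs, abs_of_nonneg (cutoff_nonneg _ _), mul_pow]
    have h0 := cutoff_nonneg (4 * R) (a - z)
    have h1 := cutoff_le_one (4 * R) (a - z)
    by_cases hz : ‖a - z‖ ≤ 8 * R
    · rw [cutoff_eq_one (by positivity) hz, one_mul]
      exact mul_le_of_le_one_left (sq_nonneg _) (by nlinarith)
    · rw [not_le] at hz
      rw [cutoff_eq_zero (by positivity) (by linarith : 2 * (4 * R) ≤ ‖a - z‖)]
      simp only [ne_eq, OfNat.ofNat_ne_zero, not_false_eq_true, zero_pow, zero_mul]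
      exact mul_nonneg (cutoff_nonneg _ _) (sq_nonneg _)

/-- **C5 — THE `L²` BOUND OF THE NEAR PART** (Stein's `L²` bound for the normalised pressure of the compactly supported smooth cut field,
`p̃[w] = Q[w]`): there is `κ₁ ≥ 0` such that for every smooth `u` with `‖u‖ ≤ N`, every centre `a` and radius `R > 0`,
`√∫_{B̄(a,2R)} Q[ϑ•u]² ≤ κ₁ · N · √∫ cutoff(8R)(a−x)‖u x‖² dx`. -/
theorem exists_sqrt_setIntegral_sq_pressurePotential_cutField_le :
    ∃ κ₁ : ℝ, 0 ≤ κ₁ ∧ ∀ (u : EuclideanSpace ℝ (Fin 3) → EuclideanSpace ℝ (Fin 3)) (N : ℝ),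
      ContDiff ℝ ∞ u → (∀ z, ‖u z‖ ≤ N) → ∀ (a : EuclideanSpace ℝ (Fin 3)) (R : ℝ), 0 < R →
      Integrable (fun x => (pressurePotential (fun z => cutoff (4 * R) (a - z) • u z) x) ^ 2) ∧
      Real.sqrt (∫ x in closedBall a (2 * R), (pressurePotential (fun z => cutoff (4 * R) (a - z) • u z) x) ^ 2) ≤
        κ₁ * N * Real.sqrt (∫ x, cutoff (8 * R) (a - x) * ‖u x‖ ^ 2) := by
  obtain ⟨CS, hCS0, hCS⟩ := stein1970_normalisedPressure_eLpNorm_le_holds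
  refine ⟨CS, hCS0, fun u N hu hN a R hR => ?_⟩
  have hN0 : 0 ≤ N := (norm_nonneg _).trans (hN 0)
  obtain ⟨hws, hwc, hwle, hwsq⟩ := cutField_smooth hu a hR
  set w : EuclideanSpace ℝ (Fin 3) → EuclideanSpace ℝ (Fin 3) := fun z => cutoff (4 * R) (a - z) • u z with hw
  have hwcont : Continuous w := hws.continuous
  have hw2 : ContDiff ℝ 2 w := contDiff_infty.1 hws 2
  have hwb : ∀ z, ‖w z‖ ≤ N := fun z => (hwle z).trans (hN z)
  have hw2c : HasCompactSupport fun y => ‖w y‖ ^ 2 := hwc.norm.comp_left (g := fun t : ℝ => t ^ 2) (zero_pow two_ne_zero)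
  have hL2w : Integrable fun y => ‖w y‖ ^ 2 := (hwcont.norm.pow 2).integrable_of_hasCompactSupport hw2c
  have hQw : pressurePotential w = normalisedPressure w := (normalisedPressure_eq_pressurePotential' hw2 hL2w).symm
  obtain ⟨hmem, hle⟩ := hCS w hws hwc
  have hN2 : MemLp (fun y => ‖w y‖ ^ 2) 2 volume := (hwcont.norm.pow 2).memLp_of_hasCompactSupport hw2c
  -- `∫ Q[w]² ≤ CS² ∫ ‖w‖⁴`
  have hp2 : ∫ x, ‖normalisedPressure w x‖ ^ 2 ≤ CS ^ 2 * ∫ x, ‖(fun y => ‖w y‖ ^ 2) x‖ ^ 2 := by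
    rw [← PineauVicol2026.integral_norm_sq_eq_of_memLp_two hmem, ← PineauVicol2026.integral_norm_sq_eq_of_memLp_two hN2]
    have h1 : (eLpNorm (normalisedPressure w) 2 volume).toReal ≤ CS * (eLpNorm (fun y => ‖w y‖ ^ 2) 2 volume).toReal := by
      have := ENNReal.toReal_mono (ENNReal.mul_ne_top ENNReal.ofReal_ne_top hN2.eLpNorm_ne_top) hle
      rwa [ENNReal.toReal_mul, ENNReal.toReal_ofReal hCS0] at this
    calc (eLpNorm (normalisedPressure w) 2 volume).toReal ^ 2
        ≤ (CS * (eLpNorm (fun y => ‖w y‖ ^ 2) 2 volume).toReal) ^ 2 := pow_le_pow_left₀ ENNReal.toReal_nonneg h1 2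
      _ = CS ^ 2 * (eLpNorm (fun y => ‖w y‖ ^ 2) 2 volume).toReal ^ 2 := by ring
  have hnorm_eq : (fun x => ‖(fun y => ‖w y‖ ^ 2) x‖ ^ 2) = fun x => ‖w x‖ ^ 4 := by
    funext x; simp only [Real.norm_eq_abs, abs_pow, abs_norm]; ring
  rw [hnorm_eq] at hp2
  -- `∫ ‖w‖⁴ ≤ N² ∫ cutoff(8R)(a−·)‖u‖²`
  have hw4c : HasCompactSupport fun y => ‖w y‖ ^ 4 := hwc.norm.comp_left (g := fun t : ℝ => t ^ 4) (zero_pow (by norm_num))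
  have hi4 : Integrable fun x => ‖w x‖ ^ 4 := (hwcont.norm.pow 4).integrable_of_hasCompactSupport hw4c
  have hc8 : Continuous fun x : EuclideanSpace ℝ (Fin 3) => cutoff (8 * R) (a - x) * ‖u x‖ ^ 2 :=
    ((contDiff_cutoff (n := 0) _).continuous.comp (continuous_const.sub continuous_id)).mul (hu.continuous.norm.pow 2)
  have hi8 : Integrable fun x => cutoff (8 * R) (a - x) * ‖u x‖ ^ 2 := by
    refine hc8.integrable_of_hasCompactSupport (HasCompactSupport.intro (isCompact_closedBall a (2 * (8 * R))) fun z hz => ?_)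
    rw [mem_closedBall, dist_eq_norm, norm_sub_rev, not_le] at hz
    rw [cutoff_eq_zero (by positivity) hz.le, zero_mul]
  have h4le : ∫ x, ‖w x‖ ^ 4 ≤ N ^ 2 * ∫ x, cutoff (8 * R) (a - x) * ‖u x‖ ^ 2 := by
    rw [← integral_const_mul]
    refine integral_mono hi4 (hi8.const_mul _) fun x => ?_
    have e : ‖w x‖ ^ 4 = ‖w x‖ ^ 2 * ‖w x‖ ^ 2 := by ring
    rw [e]
    calc ‖w x‖ ^ 2 * ‖w x‖ ^ 2 ≤ N ^ 2 * ‖w x‖ ^ 2 :=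
          mul_le_mul_of_nonneg_right (pow_le_pow_left₀ (norm_nonneg _) (hwb x) 2) (sq_nonneg _)
      _ ≤ N ^ 2 * (cutoff (8 * R) (a - x) * ‖u x‖ ^ 2) := mul_le_mul_of_nonneg_left (hwsq x) (sq_nonneg _)
  -- assemble
  have hQi : Integrable fun x => (pressurePotential w x) ^ 2 := by
    rw [hQw]; exact hmem.integrable_sq
  have hQ2 : ∫ x, (pressurePotential w x) ^ 2 ≤ (CS * N) ^ 2 * ∫ x, cutoff (8 * R) (a - x) * ‖u x‖ ^ 2 := by
    have e : ∫ x, (pressurePotential w x) ^ 2 = ∫ x, ‖normalisedPressure w x‖ ^ 2 := by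
      rw [hQw]; exact integral_congr_ae (Eventually.of_forall fun x => by simp [Real.norm_eq_abs, sq_abs])
    rw [e]
    calc ∫ x, ‖normalisedPressure w x‖ ^ 2 ≤ CS ^ 2 * ∫ x, ‖w x‖ ^ 4 := hp2
      _ ≤ CS ^ 2 * (N ^ 2 * ∫ x, cutoff (8 * R) (a - x) * ‖u x‖ ^ 2) := mul_le_mul_of_nonneg_left h4le (sq_nonneg _)
      _ = (CS * N) ^ 2 * ∫ x, cutoff (8 * R) (a - x) * ‖u x‖ ^ 2 := by ring
  have hset : ∫ x in closedBall a (2 * R), (pressurePotential w x) ^ 2 ≤ ∫ x, (pressurePotential w x) ^ 2 :=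
    setIntegral_le_integral hQi (ae_of_all _ fun x => sq_nonneg _)
  refine ⟨hQi, ?_⟩
  have hI0 : 0 ≤ ∫ x, cutoff (8 * R) (a - x) * ‖u x‖ ^ 2 :=
    integral_nonneg fun x => mul_nonneg (cutoff_nonneg _ _) (sq_nonneg _)
  calc Real.sqrt (∫ x in closedBall a (2 * R), (pressurePotential w x) ^ 2)
      ≤ Real.sqrt ((CS * N) ^ 2 * ∫ x, cutoff (8 * R) (a - x) * ‖u x‖ ^ 2) := Real.sqrt_le_sqrt (hset.trans hQ2)
    _ = CS * N * Real.sqrt (∫ x, cutoff (8 * R) (a - x) * ‖u x‖ ^ 2) := by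
        rw [Real.sqrt_mul (sq_nonneg _), Real.sqrt_sq (mul_nonneg hCS0 hN0)]

/-! ### The slice split on `B̄(a,2R)` -/

/-- **THE LOCAL SPLIT OF THE RIESZ PRESSURE MODULO CONSTANTS.**  For `R > 0`, a smooth bounded field `u`, a centre `a` and a base point `x₀`
there is a constant `c` with, for every `x ∈ B̄(a,2R)`,
`pressurePotentialMod x₀ u x = c + Q[w](x) + (Q₂^{R,2R}[w](x) − farPotentialMod R 2R x₀ u x)`, `w = cutoff(4R)(a−·) • u`
(C1 `exists_pressurePotentialMod_eq_scale_add_const`, C2, and `pressurePotential_eq_scale` for the finite-energy field `w`). -/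
theorem exists_pressurePotentialMod_split {R : ℝ} (hR : 0 < R) {u : EuclideanSpace ℝ (Fin 3) → EuclideanSpace ℝ (Fin 3)}
    (hu : ContDiff ℝ ∞ u) {N : ℝ} (hN : ∀ z, ‖u z‖ ≤ N) (a x₀ : EuclideanSpace ℝ (Fin 3)) :
    ∃ c : ℝ, ∀ x ∈ closedBall a (2 * R),
      pressurePotentialMod x₀ u x = c + pressurePotential (fun z => cutoff (4 * R) (a - z) • u z) x +
        (farPotential (R * 1) (R * 2) (fun z => cutoff (4 * R) (a - z) • u z) x - farPotentialMod (R * 1) (R * 2) x₀ u x) := by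
  obtain ⟨hws, hwc, hwle, -⟩ := cutField_smooth hu a hR
  set w : EuclideanSpace ℝ (Fin 3) → EuclideanSpace ℝ (Fin 3) := fun z => cutoff (4 * R) (a - z) • u z with hw
  have hw2 : ContDiff ℝ 2 w := contDiff_infty.1 hws 2
  have hw2c : HasCompactSupport fun y => ‖w y‖ ^ 2 := hwc.norm.comp_left (g := fun t : ℝ => t ^ 2) (zero_pow two_ne_zero)
  have hL2w : Integrable fun y => ‖w y‖ ^ 2 := (hws.continuous.norm.pow 2).integrable_of_hasCompactSupport hw2c
  obtain ⟨c, hc⟩ := exists_pressurePotentialMod_eq_scale_add_const hR (contDiff_infty.1 hu 2) hN x₀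
  refine ⟨c, fun x hx => ?_⟩
  have h1 : pressurePotentialMod x₀ u x = -nearPotential (R * 1) (R * 2) u x - farPotentialMod (R * 1) (R * 2) x₀ u x + c := hc x
  have h2 : nearPotential (R * 1) (R * 2) u x = nearPotential (R * 1) (R * 2) w x := nearPotential_eq_cutField hR hx
  have h3 : pressurePotential w x = -nearPotential (R * 1) (R * 2) w x - farPotential (R * 1) (R * 2) w x :=
    pressurePotential_eq_scale hR hw2 hL2w x
  rw [h1, h2, h3]; ring

end Summit.NavierStokesRegularity.NavierStokesRegularity.Theorems.PoloidalWindowDoorPoloidalWindowRigiditySparseEnergyPressureSplitNear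

end
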